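/-
Copyright: pub-rosobs cell (Resolution Observatory), carver gen 59 (v2: gen 60, + the fix space).  Companion file; statements
OURS — the CONVERSE half (4), and (v2) the Fix-space statement, of engine 1's THEOREM U (THEOREM-LT-eng1-g38 §14, "universal boundary normal form"): the `g28` substitution
`f₁ ↦ f₁ + σ·ℓ`, `W_n ↦ W_n + σ^p` (every other slot fixed) is a GRADED ISOTROPY of every face `a·(f₁^p − ℓ^p·W_n) + G₀`
with `ℓ, G₀` free of `f₁, W_n`, in the language of `WeightedCentreGradedIsotropy` / `WeightedCentreIsotropyTwist`.
Instrument in the cell's POLYNOMIAL weighted-centre model `W(f)` — NOT a resolution theorem, NOT a statement about the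
invariant of [AbramovichTemkinWlodarczyk2024], NOT summit progress.  AI-written Lean; AI review is weaker than expert review.
-/
import Literature.AlgebraicGeometry.Resolution.WeightedCentreGradedIsotropy
import Literature.AlgebraicGeometry.Resolution.WeightedCentreHeavyTaylor
import Mathlib.Algebra.CharP.Lemmas
import Mathlib.Algebra.MvPolynomial.Division
import Mathlib.Algebra.MvPolynomial.Monad
import Mathlib.Algebra.MvPolynomial.Variables
import Mathlib.Algebra.Polynomial.Expand
import Mathlib.RingTheory.MvPolynomial.Basic
import Mathlib.RingTheory.Polynomial.Basic
import Mathlib.Tactic.FieldSimp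
import Mathlib.Tactic.LinearCombination
import Mathlib.Tactic.Positivity
import Mathlib.Tactic.Ring
import HarnessLib

/-!
# The `g28` face and its substitution: a graded isotropy pair and its fix space (THEOREM U)

Setting (as in `WeightedCentreGradedIsotropy`): `A₀ = k[ε_ι] = MvPolynomial ι k`, parameter ring `A₀[σ] = A₀[X]`, weights
`w : ι → M`, `deg σ = ρ`.  Two distinguished slots `i` (engine 1: `f₁`, the class `1/p`) and `n` (engine 1: `W_n`, the bottom
class `1/(p+1)`), an element `ℓ ∈ k[ε]` free of `ε_i, ε_n` (engine: a linear form `ℓ(W′)` in the other bottom slots) and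
`G₀ ∈ k[ε]` free of `ε_i, ε_n` (the spectators).

* `slotSubst v` : the ring endomorphism of `k[ε][σ]` fixing `k` and `σ` with `ε_j ↦ v j` (generic plumbing), and
  `slotSubst_C_of_forall_mem_vars` : it fixes `C q` whenever `v j = ε_j` on the variables of `q`;
* `g28Subst i n ℓ p` : `ε_i ↦ ε_i + σ·ℓ`, `ε_n ↦ ε_n + σ^p`, `ε_j ↦ ε_j` otherwise ("Φ_σ" of THEOREM U (a));
* `g28Face a i n ℓ p G₀ := a·(ε_i^p − ℓ^p·ε_n) + G₀` (THEOREM U (b); the literal `g28` face `ε₁^p − ε₂^p ε₃` is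
  `g28Face (1 : k) i n (X m) p 0`, `g28Face_one_X_zero`);
* **`isIsotropyOf_g28`** (THEOREM U, converse (4)): in characteristic `p`, `Φ_σ (g) = g` for `g = g28Face …` — the displayed
  computation `(f₁ + σℓ)^p = f₁^p + σ^pℓ^p`, `ℓ^p (W_n + σ^p) = ℓ^p W_n + σ^p ℓ^p` (`add_pow_char`);
* **`isGradedHom_g28`**: `Φ_σ` is GRADED for any weights with `ρ + wt(ℓ) = w i` and `p•ρ = w n`
  (engine: `ρ = 1/(p(p+1))`, `wt ℓ = w(W) = 1/(p+1)`, `w(f₁) = 1/p`; the arithmetic is `weights_g28`);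
  **`isGradedIso_g28`**: hence `(g28Face, Φ_σ)` is an `IsGradedIso` — the first concrete instance of that structure in the tree;
* `pureCoeff_g28_snd` : the slot `ε_n` carries the PURE TERM `σ^p` (coefficient `1`), so
  `IsGradedHom.smul_eq_of_pureCoeff_ne_zero` recovers `p•ρ = w n`; `pureCoeff_g28_fst_one` : the `σ¹`-pure coefficient of
  slot `ε_i` is the constant term of `ℓ` (zero for a linear form);
* **`isIsotropyOf_g28Subst_iff`** (THEOREM U, the FIX SPACE of `Φ_σ`, both inclusions; CARVER-NOTES eng1-g39 T70, v2 of this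
  file): over a domain of characteristic `p`, for ANY nonzero `ℓ` free of `ε_i, ε_n` and `deg_i g < 2p`,
  `Φ_σ(g) = g ⇔ g = q·(ε_i^p − ℓ^p ε_n) + G₀` with `q, G₀` free of `ε_i, ε_n` (`fixSpace_g28_explicit` names `q = g /ᵐ ε_i^p`,
  `G₀ = (g %ᵐ ε_i^p)|_{ε_n := 0}`); **`isIsotropyOf_g28Subst_iff_of_isWeightedHomogeneous`**: for positive weights and `g`
  weighted-homogeneous of the weight of `ε_i^p`, `q = a ∈ k`, i.e. `Fix(Φ_σ) = a·(f₁^p − ℓ^p W_n) ⊕ {G₀}` verbatim.  Inputs,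
  all here: `coeff_one_g28Subst_C` (`[σ¹]Φ_σ(g) = ℓ·∂g/∂ε_i`, so `∂g/∂ε_i = 0`), `decomp_of_pderiv_eq_zero` (char `p`:
  `g = ε_i^p q + g₀`), the one-slot shift / kill endomorphisms `shiftSlot`, `killSlot`, `killVar`, injectivity of `expand`, and
  **(T-p)** `notMem_vars_of_shiftSlot_X_C_eq` : `q(ε_n + σ) = q ⇒ ε_n ∉ vars q` in every characteristic (evaluate at `σ = −ε_n`).
* v3 (carver-g60, section `Expand`; the decls above it are unchanged) — **T71′** (CARVER-NOTES eng1-g39): `slotSubst_expand_C`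
  (slot data composed with `σ ↦ σ^m` = `expand_m` after the substitution: "`Φ = Ψ(σ^k)`"), `isIsotropyOf_slotSubst_expand_iff`
  (`Fix(Φ) = Fix(Ψ)` on `k[ε]`, `0 < m`), `shiftSlot_X_pow_C_eq_iff` (`ε_n ↦ ε_n + σ^m` fixes `q` iff `ε_n ∉ vars q`).

What is NOT here: the direct half (1)–(3) of THEOREM U for a GENERAL sharp-rate (P)-system `Φ` (its conjugation to `Φ_σ`) —
only the fix space of `Φ_σ` itself is decided; the inputs typed so far for the general case are `WeightedCentreCharPIntegration`
(step (2)) and `WeightedCentreBinomialComparison` (step (3)); the static condition (P) on such faces; PROP B's free hypotheses.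

References: engine 1, THEOREM-LT-eng1-g38 §14, in the cell's model of [cite: AbramovichTemkinWlodarczyk2024, §5.1 (p. 1575),
Thm. 5.3.1 (2)–(3) (p. 1578)] (weighted centres; CONTEXT ONLY — the bookkeeping is ours); Frobenius additivity
[cite: Lang2002, Ch. V §6 (pp. 247–251)].
-/

namespace Literature.AlgebraicGeometry.Resolution.WeightedBlowup.G28Face

open Polynomial

noncomputable section

variable {k : Type*} [CommRing k] {ι : Type*}

/-! ## Substitutions from slot data -/

section SlotSubst

/-- The ring endomorphism of `k[ε][σ]` fixing `k` and `σ` with `ε_j ↦ v j` (construction, ours).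
[cite: AbramovichTemkinWlodarczyk2024, Thm. 5.3.1 (2)–(3) (p. 1578)] -/
def slotSubst (v : ι → (MvPolynomial ι k)[X]) : (MvPolynomial ι k)[X] →+* (MvPolynomial ι k)[X] :=
  eval₂RingHom (MvPolynomial.eval₂Hom (C.comp MvPolynomial.C) v) X

variable (v : ι → (MvPolynomial ι k)[X])

/-- `slotSubst v σ = σ` (plumbing). [cite: AbramovichTemkinWlodarczyk2024, Thm. 5.3.1 (2)–(3) (p. 1578)] -/
@[simp] theorem slotSubst_X : slotSubst v X = X := by
  rw [slotSubst, coe_eval₂RingHom, eval₂_X]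

/-- `slotSubst v` fixes the scalars (plumbing). [cite: AbramovichTemkinWlodarczyk2024, Thm. 5.3.1 (2)–(3) (p. 1578)] -/
@[simp] theorem slotSubst_C_C (c : k) : slotSubst v (C (MvPolynomial.C c)) = C (MvPolynomial.C c) := by
  rw [slotSubst, coe_eval₂RingHom, eval₂_C, MvPolynomial.eval₂Hom_C, RingHom.comp_apply]

/-- `slotSubst v ε_j = v j` (plumbing). [cite: AbramovichTemkinWlodarczyk2024, Thm. 5.3.1 (2)–(3) (p. 1578)] -/
@[simp] theorem slotSubst_C_X (j : ι) : slotSubst v (C (MvPolynomial.X j)) = v j := by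
  rw [slotSubst, coe_eval₂RingHom, eval₂_C, MvPolynomial.eval₂Hom_X']

/-- A slot substitution FIXES every `q ∈ k[ε]` on whose variables it is the identity (derived here).
[cite: AbramovichTemkinWlodarczyk2024, Thm. 5.3.1 (2)–(3) (p. 1578)] -/
theorem slotSubst_C_of_forall_mem_vars (q : MvPolynomial ι k) (h : ∀ j ∈ q.vars, v j = C (MvPolynomial.X j)) :
    slotSubst v (C q) = C q := by
  have key := MvPolynomial.hom_congr_vars (f₁ := (slotSubst v).comp C)
    (f₂ := (C : MvPolynomial ι k →+* (MvPolynomial ι k)[X])) (p₁ := q) (p₂ := q)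
    (by ext c; simp only [RingHom.comp_apply, slotSubst_C_C])
    (fun j hj _ => by simp only [RingHom.comp_apply, slotSubst_C_X, h j hj]) rfl
  rwa [RingHom.comp_apply] at key

end SlotSubst

/-! ## The `g28` substitution and face -/

section G28

variable [DecidableEq ι]

/-- Slot data of the `g28` substitution (ours): `ε_i ↦ ε_i + σ·ℓ`, `ε_n ↦ ε_n + σ^p`, `ε_j ↦ ε_j` otherwise.
[cite: AbramovichTemkinWlodarczyk2024, Thm. 5.3.1 (2)–(3) (p. 1578)] -/
def g28Data (i n : ι) (ℓ : MvPolynomial ι k) (p : ℕ) (j : ι) : (MvPolynomial ι k)[X] :=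
  if j = i then C (MvPolynomial.X i) + X * C ℓ
  else if j = n then C (MvPolynomial.X n) + X ^ p else C (MvPolynomial.X j)

/-- The `g28` substitution `Φ_σ` of THEOREM U (a) (ours). [cite: AbramovichTemkinWlodarczyk2024, Thm. 5.3.1 (2)–(3) (p. 1578)] -/
def g28Subst (i n : ι) (ℓ : MvPolynomial ι k) (p : ℕ) : (MvPolynomial ι k)[X] →+* (MvPolynomial ι k)[X] :=
  slotSubst (g28Data i n ℓ p)

/-- The face `a·(ε_i^p − ℓ^p·ε_n) + G₀` of THEOREM U (b) (ours). [cite: AbramovichTemkinWlodarczyk2024, Thm. 5.3.1 (2)–(3) (p. 1578)] -/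
def g28Face (a : k) (i n : ι) (ℓ : MvPolynomial ι k) (p : ℕ) (G₀ : MvPolynomial ι k) : MvPolynomial ι k :=
  MvPolynomial.C a * (MvPolynomial.X i ^ p - ℓ ^ p * MvPolynomial.X n) + G₀

variable (i n : ι) (ℓ : MvPolynomial ι k) (p : ℕ)

omit [DecidableEq ι] in
/-- The literal `g28` polynomial `ε_i^p − ε_m^p ε_n` is the case `a = 1`, `ℓ = ε_m`, `G₀ = 0` (plumbing).
[cite: AbramovichTemkinWlodarczyk2024, Thm. 5.3.1 (2)–(3) (p. 1578)] -/
theorem g28Face_one_X_zero (m : ι) :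
    g28Face (1 : k) i n (MvPolynomial.X m) p 0 = MvPolynomial.X i ^ p - MvPolynomial.X m ^ p * MvPolynomial.X n := by
  rw [g28Face, MvPolynomial.C_1, one_mul, add_zero]

/-- `Φ_σ σ = σ` (plumbing). [cite: AbramovichTemkinWlodarczyk2024, Thm. 5.3.1 (2)–(3) (p. 1578)] -/
@[simp] theorem g28Subst_X : g28Subst i n ℓ p X = X := slotSubst_X _

/-- `Φ_σ` fixes the scalars (plumbing). [cite: AbramovichTemkinWlodarczyk2024, Thm. 5.3.1 (2)–(3) (p. 1578)] -/
@[simp] theorem g28Subst_C_C (c : k) : g28Subst i n ℓ p (C (MvPolynomial.C c)) = C (MvPolynomial.C c) :=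
  slotSubst_C_C _ c

/-- `Φ_σ ε_i = ε_i + σ·ℓ` (plumbing). [cite: AbramovichTemkinWlodarczyk2024, Thm. 5.3.1 (2)–(3) (p. 1578)] -/
theorem g28Subst_C_X_fst : g28Subst i n ℓ p (C (MvPolynomial.X i)) = C (MvPolynomial.X i) + X * C ℓ := by
  rw [g28Subst, slotSubst_C_X, g28Data, if_pos rfl]

variable {i n}

/-- `Φ_σ ε_n = ε_n + σ^p` (plumbing). [cite: AbramovichTemkinWlodarczyk2024, Thm. 5.3.1 (2)–(3) (p. 1578)] -/
theorem g28Subst_C_X_snd (hin : i ≠ n) : g28Subst i n ℓ p (C (MvPolynomial.X n)) = C (MvPolynomial.X n) + X ^ p := by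
  rw [g28Subst, slotSubst_C_X, g28Data, if_neg (Ne.symm hin), if_pos rfl]

/-- `Φ_σ ε_j = ε_j` for `j ≠ i, n` (plumbing). [cite: AbramovichTemkinWlodarczyk2024, Thm. 5.3.1 (2)–(3) (p. 1578)] -/
theorem g28Subst_C_X_of_ne {j : ι} (hji : j ≠ i) (hjn : j ≠ n) :
    g28Subst i n ℓ p (C (MvPolynomial.X j)) = C (MvPolynomial.X j) := by
  rw [g28Subst, slotSubst_C_X, g28Data, if_neg hji, if_neg hjn]

/-- **`Φ_σ` FIXES EVERY `q ∈ k[ε]` free of `ε_i, ε_n`** (THEOREM U (a): "Φ fixes every other slot") (derived here).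
[cite: AbramovichTemkinWlodarczyk2024, Thm. 5.3.1 (2)–(3) (p. 1578)] -/
theorem g28Subst_C_of_notMem {q : MvPolynomial ι k} (hi : i ∉ q.vars) (hn : n ∉ q.vars) :
    g28Subst i n ℓ p (C q) = C q := by
  refine slotSubst_C_of_forall_mem_vars _ q fun j hj => ?_
  rw [g28Data, if_neg (fun h : j = i => hi (h ▸ hj)), if_neg (fun h : j = n => hn (h ▸ hj))]

/-- **THEOREM U, converse (4)** (derived here): in characteristic `p`, for `ℓ, G₀` free of `ε_i, ε_n` and any `a`, the `g28`
substitution is an ISOTROPY of the face `a·(ε_i^p − ℓ^p ε_n) + G₀`: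
`(ε_i + σℓ)^p = ε_i^p + σ^pℓ^p` and `ℓ^p(ε_n + σ^p) = ℓ^pε_n + σ^pℓ^p` cancel. [cite: Lang2002, Ch. V §6 (pp. 247–251)] -/
theorem isIsotropyOf_g28 [Fact p.Prime] [CharP k p] (hin : i ≠ n) {G₀ : MvPolynomial ι k} (hℓi : i ∉ ℓ.vars)
    (hℓn : n ∉ ℓ.vars) (hGi : i ∉ G₀.vars) (hGn : n ∉ G₀.vars) (a : k) :
    IsIsotropyOf (g28Face a i n ℓ p G₀) (g28Subst i n ℓ p) := by
  have hℓ : g28Subst i n ℓ p (C ℓ) = C ℓ := g28Subst_C_of_notMem ℓ p hℓi hℓn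
  have hG : g28Subst i n ℓ p (C G₀) = C G₀ := g28Subst_C_of_notMem ℓ p hGi hGn
  unfold IsIsotropyOf
  simp only [g28Face, map_add, map_mul, map_sub, map_pow, g28Subst_C_C, g28Subst_C_X_fst, g28Subst_C_X_snd ℓ p hin, hℓ, hG]
  rw [add_pow_char _ _ p]
  ring

/-- The constant `a` and the spectator `G₀` may of course be varied: the fixed ring of `Φ_σ` contains the `k[ε ∖ {ε_i, ε_n}]`-span of
`1` and `ε_i^p − ℓ^p ε_n` (derived here; THEOREM U: "their Fix spaces are `a(f₁^p − ℓ^pW_n) ⊕ {G₀}`", the easy inclusion).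
[cite: Lang2002, Ch. V §6 (pp. 247–251)] -/
theorem isIsotropyOf_g28_mul [Fact p.Prime] [CharP k p] (hin : i ≠ n) {b G₀ : MvPolynomial ι k} (hℓi : i ∉ ℓ.vars)
    (hℓn : n ∉ ℓ.vars) (hbi : i ∉ b.vars) (hbn : n ∉ b.vars) (hGi : i ∉ G₀.vars) (hGn : n ∉ G₀.vars) :
    IsIsotropyOf (b * (MvPolynomial.X i ^ p - ℓ ^ p * MvPolynomial.X n) + G₀) (g28Subst i n ℓ p) := by
  have hℓ : g28Subst i n ℓ p (C ℓ) = C ℓ := g28Subst_C_of_notMem ℓ p hℓi hℓn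
  have hb : g28Subst i n ℓ p (C b) = C b := g28Subst_C_of_notMem ℓ p hbi hbn
  have hG : g28Subst i n ℓ p (C G₀) = C G₀ := g28Subst_C_of_notMem ℓ p hGi hGn
  unfold IsIsotropyOf
  simp only [map_add, map_mul, map_sub, map_pow, g28Subst_C_X_fst, g28Subst_C_X_snd ℓ p hin, hℓ, hb, hG]
  rw [add_pow_char _ _ p]
  ring

end G28

/-! ## Grading -/

section Graded

variable [DecidableEq ι] {M : Type*} [AddCommGroup M] {w : ι → M} {ρ δ : M} {i n : ι} {ℓ : MvPolynomial ι k} {p : ℕ}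

/-- **`Φ_σ` is graded** (derived here): if `ℓ` is weighted-homogeneous of weight `δ` with `ρ + δ = w i` and `p•ρ = w n`, then
`g28Subst i n ℓ p` is an `IsGradedHom w ρ`. [cite: AbramovichTemkinWlodarczyk2024, Thm. 5.3.1 (2)–(3) (p. 1578)] -/
theorem isGradedHom_g28 (hin : i ≠ n) (hℓ : MvPolynomial.IsWeightedHomogeneous w ℓ δ) (hδ : ρ + δ = w i)
    (hn : p • ρ = w n) : IsGradedHom w ρ (g28Subst i n ℓ p) where
  map_C_C := g28Subst_C_C i n ℓ p
  isTW_X := by rw [g28Subst_X]; exact isTW_X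
  isTW_CX := by
    intro j
    by_cases hji : j = i
    · rw [hji, g28Subst_C_X_fst]
      refine (isTW_C (MvPolynomial.isWeightedHomogeneous_X k w i)).add ?_
      rw [← hδ]
      exact isTW_X.mul (isTW_C hℓ)
    · by_cases hjn : j = n
      · rw [hjn, g28Subst_C_X_snd ℓ p hin]
        refine (isTW_C (MvPolynomial.isWeightedHomogeneous_X k w n)).add ?_
        rw [← hn]
        exact isTW_X.pow p
      · rw [g28Subst_C_X_of_ne ℓ p hji hjn]
        exact isTW_C (MvPolynomial.isWeightedHomogeneous_X k w j)

/-- **THEOREM U, converse, graded form** (derived here): `(a·(ε_i^p − ℓ^p ε_n) + G₀, Φ_σ)` is a GRADED ISOTROPY PAIR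
(`IsGradedIso`) in characteristic `p`, for `ℓ, G₀` free of `ε_i, ε_n`, `ℓ` homogeneous of weight `w i − ρ`, `p•ρ = w n`.
[cite: AbramovichTemkinWlodarczyk2024, Thm. 5.3.1 (2)–(3) (p. 1578)] -/
theorem isGradedIso_g28 [Fact p.Prime] [CharP k p] (hin : i ≠ n) {G₀ : MvPolynomial ι k}
    (hℓ : MvPolynomial.IsWeightedHomogeneous w ℓ δ) (hδ : ρ + δ = w i) (hn : p • ρ = w n)
    (hℓi : i ∉ ℓ.vars) (hℓn : n ∉ ℓ.vars) (hGi : i ∉ G₀.vars) (hGn : n ∉ G₀.vars) (a : k) :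
    IsGradedIso w ρ (g28Face a i n ℓ p G₀) (g28Subst i n ℓ p) where
  graded := isGradedHom_g28 hin hℓ hδ hn
  map_X := g28Subst_X i n ℓ p
  iso := isIsotropyOf_g28 ℓ p hin hℓi hℓn hGi hGn a

/-- Hence all its twists `Φ_{−σ}`, `Γ_σ = Φ ∘ Φ_{−σ}` are graded isotropies of the same face (derived here, from the closure
lemmas of `WeightedCentreGradedIsotropy`). [cite: AbramovichTemkinWlodarczyk2024, Thm. 5.3.1 (2)–(3) (p. 1578)] -/
theorem isGradedIso_g28_gammaOf [Fact p.Prime] [CharP k p] (hin : i ≠ n) {G₀ : MvPolynomial ι k}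
    (hℓ : MvPolynomial.IsWeightedHomogeneous w ℓ δ) (hδ : ρ + δ = w i) (hn : p • ρ = w n)
    (hℓi : i ∉ ℓ.vars) (hℓn : n ∉ ℓ.vars) (hGi : i ∉ G₀.vars) (hGn : n ∉ G₀.vars) (a : k) :
    IsGradedIso w ρ (g28Face a i n ℓ p G₀) (gammaOf (g28Subst i n ℓ p)) :=
  (isGradedIso_g28 hin hℓ hδ hn hℓi hℓn hGi hGn a).gammaOf

/-- **The pure term `σ^p` of slot `ε_n`** (derived here): `pureCoeff Φ_σ n p = 1`; with `IsGradedHom.smul_eq_of_pureCoeff_ne_zero`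
this recovers the exponent bookkeeping `p•ρ = w n`. [cite: AbramovichTemkinWlodarczyk2024, Thm. 5.3.1 (2)–(3) (p. 1578)] -/
theorem pureCoeff_g28_snd (hin : i ≠ n) (hp : p ≠ 0) : pureCoeff (g28Subst i n ℓ p) n p = 1 := by
  rw [pureCoeff, g28Subst_C_X_snd ℓ p hin, coeff_add, coeff_C, if_neg hp, zero_add, coeff_X_pow, if_pos rfl,
    ← MvPolynomial.C_1, MvPolynomial.coeff_zero_C]

/-- The exponent bookkeeping recovered from the pure term (derived here): a graded `Φ_σ` forces `p•ρ = w n`.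
[cite: AbramovichTemkinWlodarczyk2024, Thm. 5.3.1 (2)–(3) (p. 1578)] -/
theorem smul_eq_of_isGradedHom_g28 [Nontrivial k] (hin : i ≠ n) (hp : p ≠ 0) (hΦ : IsGradedHom w ρ (g28Subst i n ℓ p)) :
    p • ρ = w n :=
  hΦ.smul_eq_of_pureCoeff_ne_zero (by rw [pureCoeff_g28_snd hin hp]; exact one_ne_zero)

/-- **The `σ¹`-pure coefficient of slot `ε_i` is the constant term of `ℓ`** (derived here): zero when `ℓ` is a linear form,
so slot `f₁` carries no pure term. [cite: AbramovichTemkinWlodarczyk2024, Thm. 5.3.1 (2)–(3) (p. 1578)] -/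
theorem pureCoeff_g28_fst_one : pureCoeff (g28Subst i n ℓ p) i 1 = MvPolynomial.coeff 0 ℓ := by
  rw [pureCoeff, g28Subst_C_X_fst, coeff_add, coeff_C, if_neg one_ne_zero, zero_add, coeff_X_mul, coeff_C_zero]

end Graded

/-! ## The weights of engine 1 -/

/-- Engine 1's weights are consistent with the grading hypotheses of `isGradedHom_g28` (derived here):
with `ρ = 1/(p(p+1))`, `w(W) = 1/(p+1)`, `w(f₁) = 1/p`: `p·ρ = w(W_n)` and `ρ + w(W) = w(f₁)` (`ℓ` linear in `W′` has weight `w(W)`).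
[cite: AbramovichTemkinWlodarczyk2024, §5.1 (p. 1575)] -/
theorem weights_g28 (p : ℕ) (hp : p ≠ 0) :
    (p : ℚ) * (1 / ((p : ℚ) * (p + 1))) = 1 / ((p : ℚ) + 1) ∧
      1 / ((p : ℚ) * (p + 1)) + 1 / ((p : ℚ) + 1) = 1 / (p : ℚ) := by
  have hp' : (p : ℚ) ≠ 0 := Nat.cast_ne_zero.mpr hp
  have hp1 : (p : ℚ) + 1 ≠ 0 := by positivity
  constructor
  · field_simp
  · field_simp
    ring

/-! ## The fix space of `Φ_σ` (THEOREM U: `Fix(Φ_σ) = a·(f₁^p − ℓ^p W_n) ⊕ {G₀}`; CARVER-NOTES eng1-g39 T70)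

The DIRECT inclusion, complementing `isIsotropyOf_g28` / `isIsotropyOf_g28_mul`.  Frobenius is used only in the two main
theorems; the substitution plumbing holds over any commutative ring `k`.  Outline: `[σ¹] Φ_σ(g) = ℓ·∂g/∂ε_i`
(`coeff_one_g28Subst_C`), so an isotropy has `∂g/∂ε_i = 0`, whence (characteristic `p`, `deg_i g < 2p`) `g = ε_i^p·q + g₀` with
`q, g₀` free of `ε_i` (`decomp_of_pderiv_eq_zero`); by `(ε_i + σℓ)^p = ε_i^p + σ^pℓ^p` the isotropy equation splits, after
killing `ε_i`, into `q(ε_n + σ^p) = q` and `g₀(ε_n + σ^p) − g₀ = −σ^p ℓ^p q`; `σ ↦ σ^p` (`expand`) is injective and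
**(T-p)** `q(ε_n + σ) = q ⇒ ε_n ∉ vars q` (evaluate at `σ = −ε_n`), which also produces `G₀ := g₀|_{ε_n := 0}` with
`g₀ = G₀ − ε_n ℓ^p q`, i.e. `g = q·(ε_i^p − ℓ^p ε_n) + G₀`. -/

section FixSpace

variable [DecidableEq ι]

/-! ### `σ⁰`- and `σ¹`-coefficients of a slot substitution -/

section Coeff

variable (v : ι → (MvPolynomial ι k)[X])

omit [DecidableEq ι] in
/-- If `v j ≡ ε_j (mod σ)` for every slot, `slotSubst v` is the identity modulo `σ` on `k[ε]`: `[σ⁰] (slotSubst v q) = q`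
(derived here; plumbing). [cite: AbramovichTemkinWlodarczyk2024, Thm. 5.3.1 (2)–(3) (p. 1578)] -/
theorem coeff_zero_slotSubst_C (h0 : ∀ j, (v j).coeff 0 = MvPolynomial.X j) (q : MvPolynomial ι k) :
    (slotSubst v (C q)).coeff 0 = q := by
  have key : (evalRingHom 0).comp ((slotSubst v).comp C) = RingHom.id (MvPolynomial ι k) := by
    refine MvPolynomial.ringHom_ext (fun c => ?_) (fun j => ?_)
    · rw [RingHom.comp_apply, RingHom.comp_apply, slotSubst_C_C, coe_evalRingHom, eval_C, RingHom.id_apply]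
    · rw [RingHom.comp_apply, RingHom.comp_apply, slotSubst_C_X, coe_evalRingHom, ← coeff_zero_eq_eval_zero, h0,
        RingHom.id_apply]
  have h := RingHom.congr_fun key q
  rwa [RingHom.comp_apply, RingHom.comp_apply, coe_evalRingHom, ← coeff_zero_eq_eval_zero, RingHom.id_apply] at h

/-- **First-order term of a slot substitution = a derivation** (derived here): if `v j ≡ ε_j (mod σ)` for all `j` and
`[σ¹] (v j)` is `ℓ` for `j = i` and `0` otherwise, then `[σ¹] (slotSubst v q) = ℓ · ∂q/∂ε_i` (Leibniz rule, induction on `q`).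
[cite: AbramovichTemkinWlodarczyk2024, §5.1 (p. 1575)] -/
theorem coeff_one_slotSubst_C (h0 : ∀ j, (v j).coeff 0 = MvPolynomial.X j) (i : ι) (ℓ : MvPolynomial ι k)
    (h1 : ∀ j, (v j).coeff 1 = if j = i then ℓ else 0) (q : MvPolynomial ι k) :
    (slotSubst v (C q)).coeff 1 = ℓ * MvPolynomial.pderiv i q := by
  induction q using MvPolynomial.induction_on with
  | C c => rw [slotSubst_C_C, coeff_C, if_neg one_ne_zero, MvPolynomial.pderiv_C, mul_zero]
  | add f g hf hg => simp only [map_add, coeff_add, hf, hg, mul_add]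
  | mul_X f j hf =>
    have hanti : Finset.antidiagonal (1 : ℕ) = {(0, 1), (1, 0)} := by decide
    have hne : ((0, 1) : ℕ × ℕ) ≠ (1, 0) := by decide
    rw [map_mul, map_mul, slotSubst_C_X, coeff_mul, hanti, Finset.sum_pair hne]
    simp only [coeff_zero_slotSubst_C v h0, hf, h0, h1, MvPolynomial.pderiv_mul]
    by_cases hji : j = i
    · rw [if_pos hji, hji, MvPolynomial.pderiv_X_self]
      ring
    · rw [if_neg hji, MvPolynomial.pderiv_X_of_ne hji]
      ring

end Coeff

/-! ### The linearisation of `Φ_σ` is `ℓ·∂/∂ε_i` -/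

section G28Coeff

variable {i n : ι} (ℓ : MvPolynomial ι k) {p : ℕ}

/-- `Φ_σ ≡ id (mod σ)` on every slot (`p ≠ 0`) (plumbing). [cite: AbramovichTemkinWlodarczyk2024, Thm. 5.3.1 (2)–(3) (p. 1578)] -/
theorem coeff_zero_g28Data (hp : p ≠ 0) (j : ι) : (g28Data i n ℓ p j).coeff 0 = MvPolynomial.X j := by
  by_cases hji : j = i
  · rw [hji, g28Data, if_pos rfl, coeff_add, coeff_C_zero, coeff_X_mul_zero, add_zero]
  · by_cases hjn : j = n
    · rw [hjn, g28Data, if_neg (Ne.symm (fun h => hji (hjn.trans h.symm))), if_pos rfl, coeff_add, coeff_C_zero,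
        coeff_X_pow, if_neg (fun h => hp h.symm), add_zero]
    · rw [g28Data, if_neg hji, if_neg hjn, coeff_C_zero]

/-- `[σ¹]` of the slots of `Φ_σ`: `ℓ` at `ε_i`, `0` elsewhere (`p ≠ 1`) (plumbing).
[cite: AbramovichTemkinWlodarczyk2024, Thm. 5.3.1 (2)–(3) (p. 1578)] -/
theorem coeff_one_g28Data (hp : p ≠ 1) (j : ι) : (g28Data i n ℓ p j).coeff 1 = if j = i then ℓ else 0 := by
  by_cases hji : j = i
  · rw [if_pos hji, hji, g28Data, if_pos rfl, coeff_add, coeff_C, if_neg one_ne_zero, zero_add, coeff_X_mul, coeff_C_zero]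
  · rw [if_neg hji, g28Data, if_neg hji]
    by_cases hjn : j = n
    · rw [if_pos hjn, coeff_add, coeff_C, if_neg one_ne_zero, zero_add, coeff_X_pow, if_neg (fun h => hp h.symm)]
    · rw [if_neg hjn, coeff_C, if_neg one_ne_zero]

/-- `[σ⁰] Φ_σ(q) = q` for every `q ∈ k[ε]` (derived here; plumbing). [cite: AbramovichTemkinWlodarczyk2024, Thm. 5.3.1 (2)–(3) (p. 1578)] -/
theorem coeff_zero_g28Subst_C (hp : p ≠ 0) (q : MvPolynomial ι k) : (g28Subst i n ℓ p (C q)).coeff 0 = q :=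
  coeff_zero_slotSubst_C _ (coeff_zero_g28Data ℓ hp) q

/-- **`[σ¹] Φ_σ(q) = ℓ · ∂q/∂ε_i`** (derived here): the linearisation of the `g28` substitution is the derivation `ℓ·∂/∂f₁`
(`p ≠ 0, 1`; "the linear heart of THEOREM U"). [cite: AbramovichTemkinWlodarczyk2024, §5.1 (p. 1575)] -/
theorem coeff_one_g28Subst_C (hp0 : p ≠ 0) (hp1 : p ≠ 1) (q : MvPolynomial ι k) :
    (g28Subst i n ℓ p (C q)).coeff 1 = ℓ * MvPolynomial.pderiv i q :=
  coeff_one_slotSubst_C _ (coeff_zero_g28Data ℓ hp0) i ℓ (coeff_one_g28Data ℓ hp1) q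

/-- Hence, over a domain and for `ℓ ≠ 0`, an isotropy `Φ_σ(g) = g` has `∂g/∂ε_i = 0` (derived here).
[cite: AbramovichTemkinWlodarczyk2024, §5.1 (p. 1575)] -/
theorem pderiv_eq_zero_of_isIsotropyOf [IsDomain k] (hp0 : p ≠ 0) (hp1 : p ≠ 1) (hℓ0 : ℓ ≠ 0) {g : MvPolynomial ι k}
    (hg : IsIsotropyOf g (g28Subst i n ℓ p)) : MvPolynomial.pderiv i g = 0 := by
  have h1 := coeff_one_g28Subst_C (i := i) (n := n) ℓ hp0 hp1 g
  unfold IsIsotropyOf at hg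
  rw [hg, coeff_C, if_neg one_ne_zero] at h1
  exact (mul_eq_zero.mp h1.symm).resolve_left hℓ0

end G28Coeff

/-! ### Characteristic `p`: `∂g/∂ε_i = 0` makes `g` a polynomial in `ε_i^p` -/

section Frobenius

variable {p : ℕ} [CharP k p] [IsDomain k] {i : ι} {g : MvPolynomial ι k}

/-- In characteristic `p` over a domain, `∂g/∂ε_i = 0` forces `p ∣ m i` for every monomial `m` of `g` (derived here).
[cite: Lang2002, Ch. V §6 (pp. 247–251)] -/
theorem dvd_of_pderiv_eq_zero (h : MvPolynomial.pderiv i g = 0) {m : ι →₀ ℕ} (hm : m ∈ g.support) : p ∣ m i := by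
  by_cases hmi : m i = 0
  · rw [hmi]; exact dvd_zero p
  have htm : m - Finsupp.single i 1 + Finsupp.single i 1 = m :=
    tsub_add_cancel_of_le (Finsupp.single_le_iff.mpr (Nat.one_le_iff_ne_zero.mpr hmi))
  have hti : (m - Finsupp.single i 1 : ι →₀ ℕ) i + 1 = m i := by
    rw [Finsupp.tsub_apply, Finsupp.single_eq_same]; omega
  have hc := coeff_pderiv_eq i g (m - Finsupp.single i 1)
  rw [h, MvPolynomial.coeff_zero, htm, hti] at hc
  rcases mul_eq_zero.mp hc.symm with h1 | h1
  · exact (CharP.cast_eq_zero_iff k p (m i)).mp h1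
  · exact absurd h1 (MvPolynomial.mem_support_iff.mp hm)

/-- … and then, if `deg_i g < 2p`, `g = ε_i^p · q + g₀` with `q := g /ᵐ ε_i^p`, `g₀ := g %ᵐ ε_i^p` BOTH FREE OF `ε_i`
(derived here).  The bound is needed: `(ε_i^p − ℓ^p ε_n)²` is fixed by `Φ_σ` and is not of the THEOREM U shape.
[cite: Lang2002, Ch. V §6 (pp. 247–251)] -/
theorem decomp_of_pderiv_eq_zero (hp : 0 < p) (h : MvPolynomial.pderiv i g = 0) (hdeg : g.degreeOf i < 2 * p) :
    g = MvPolynomial.X i ^ p * g.divMonomial (Finsupp.single i p) + g.modMonomial (Finsupp.single i p) ∧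
      i ∉ (g.divMonomial (Finsupp.single i p)).vars ∧ i ∉ (g.modMonomial (Finsupp.single i p)).vars := by
  have hsupp : ∀ m ∈ g.support, m i < 2 * p := (MvPolynomial.degreeOf_lt_iff (by omega)).mp hdeg
  refine ⟨?_, ?_, ?_⟩
  · rw [MvPolynomial.X_pow_eq_monomial, MvPolynomial.divMonomial_add_modMonomial]
  · rw [MvPolynomial.mem_vars_iff_mem_support]
    rintro ⟨d, hd, hid⟩
    have hc : MvPolynomial.coeff (Finsupp.single i p + d) g ≠ 0 := by
      rw [← MvPolynomial.coeff_divMonomial]; exact MvPolynomial.mem_support_iff.mp hd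
    have hm : Finsupp.single i p + d ∈ g.support := MvPolynomial.mem_support_iff.mpr hc
    have h1 := dvd_of_pderiv_eq_zero h hm
    have h2 := hsupp _ hm
    rw [Finsupp.add_apply, Finsupp.single_eq_same] at h1 h2
    have h3 : p ∣ d i := (Nat.dvd_add_right (dvd_refl p)).mp h1
    exact (Finsupp.mem_support_iff.mp hid) (Nat.eq_zero_of_dvd_of_lt h3 (by omega))
  · rw [MvPolynomial.mem_vars_iff_mem_support]
    rintro ⟨d, hd, hid⟩
    have hle : ¬ Finsupp.single i p ≤ d := fun hle =>
      (MvPolynomial.mem_support_iff.mp hd) (MvPolynomial.coeff_modMonomial_of_le g hle)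
    have hc : MvPolynomial.coeff d g ≠ 0 := by
      rw [← MvPolynomial.coeff_modMonomial_of_not_le g hle]; exact MvPolynomial.mem_support_iff.mp hd
    have h1 : p ∣ d i := dvd_of_pderiv_eq_zero h (MvPolynomial.mem_support_iff.mpr hc)
    have h4 : d i < p := by rw [Finsupp.single_le_iff] at hle; omega
    exact (Finsupp.mem_support_iff.mp hid) (Nat.eq_zero_of_dvd_of_lt h1 h4)

end Frobenius

/-! ### One-slot shifts, one-slot kills, and (T-p) -/

section Shift

/-- Slot data of the ONE-SLOT SHIFT `ε_n ↦ ε_n + t`, every other slot fixed (ours).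
[cite: AbramovichTemkinWlodarczyk2024, Thm. 5.3.1 (2)–(3) (p. 1578)] -/
def shiftData (n : ι) (t : (MvPolynomial ι k)[X]) (j : ι) : (MvPolynomial ι k)[X] :=
  if j = n then C (MvPolynomial.X n) + t else C (MvPolynomial.X j)

/-- The one-slot shift `ε_n ↦ ε_n + t` as a ring endomorphism of `k[ε][σ]` fixing `k` and `σ` (ours).
[cite: AbramovichTemkinWlodarczyk2024, Thm. 5.3.1 (2)–(3) (p. 1578)] -/
def shiftSlot (n : ι) (t : (MvPolynomial ι k)[X]) : (MvPolynomial ι k)[X] →+* (MvPolynomial ι k)[X] :=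
  slotSubst (shiftData n t)

/-- Slot data KILLING slot `m`: `ε_m ↦ 0`, every other slot fixed (ours). [cite: AbramovichTemkinWlodarczyk2024, Thm. 5.3.1 (2)–(3) (p. 1578)] -/
def killData (m : ι) (j : ι) : (MvPolynomial ι k)[X] := if j = m then 0 else C (MvPolynomial.X j)

/-- `ε_m ↦ 0` as a ring endomorphism of `k[ε][σ]` fixing `k` and `σ` (ours). [cite: AbramovichTemkinWlodarczyk2024, Thm. 5.3.1 (2)–(3) (p. 1578)] -/
def killSlot (m : ι) : (MvPolynomial ι k)[X] →+* (MvPolynomial ι k)[X] := slotSubst (killData m)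

/-- `ε_n ↦ 0` on the slots of `k[ε]` itself (ours). [cite: AbramovichTemkinWlodarczyk2024, Thm. 5.3.1 (2)–(3) (p. 1578)] -/
def killFun (n : ι) (j : ι) : MvPolynomial ι k := if j = n then 0 else MvPolynomial.X j

/-- `ε_n ↦ 0` on `k[ε]` (ours). [cite: AbramovichTemkinWlodarczyk2024, Thm. 5.3.1 (2)–(3) (p. 1578)] -/
def killVar (n : ι) : MvPolynomial ι k →ₐ[k] MvPolynomial ι k := MvPolynomial.aeval (killFun n)

variable (n : ι) (t : (MvPolynomial ι k)[X])

/-- (plumbing) [cite: AbramovichTemkinWlodarczyk2024, Thm. 5.3.1 (2)–(3) (p. 1578)] -/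
@[simp] theorem shiftSlot_X : shiftSlot n t X = X := slotSubst_X _

/-- (plumbing) [cite: AbramovichTemkinWlodarczyk2024, Thm. 5.3.1 (2)–(3) (p. 1578)] -/
@[simp] theorem shiftSlot_C_C (c : k) : shiftSlot n t (C (MvPolynomial.C c)) = C (MvPolynomial.C c) := slotSubst_C_C _ c

/-- `ε_n ↦ ε_n + t` (plumbing). [cite: AbramovichTemkinWlodarczyk2024, Thm. 5.3.1 (2)–(3) (p. 1578)] -/
theorem shiftSlot_C_X_self : shiftSlot n t (C (MvPolynomial.X n)) = C (MvPolynomial.X n) + t := by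
  rw [shiftSlot, slotSubst_C_X, shiftData, if_pos rfl]

variable {n} in
/-- `ε_j ↦ ε_j` for `j ≠ n` (plumbing). [cite: AbramovichTemkinWlodarczyk2024, Thm. 5.3.1 (2)–(3) (p. 1578)] -/
theorem shiftSlot_C_X_of_ne {j : ι} (h : j ≠ n) : shiftSlot n t (C (MvPolynomial.X j)) = C (MvPolynomial.X j) := by
  rw [shiftSlot, slotSubst_C_X, shiftData, if_neg h]

/-- (plumbing) [cite: AbramovichTemkinWlodarczyk2024, Thm. 5.3.1 (2)–(3) (p. 1578)] -/
@[simp] theorem killSlot_X : killSlot n X = (X : (MvPolynomial ι k)[X]) := slotSubst_X _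

/-- (plumbing) [cite: AbramovichTemkinWlodarczyk2024, Thm. 5.3.1 (2)–(3) (p. 1578)] -/
@[simp] theorem killSlot_C_C (c : k) : killSlot n (C (MvPolynomial.C c)) = (C (MvPolynomial.C c) : (MvPolynomial ι k)[X]) :=
  slotSubst_C_C _ c

/-- `ε_n ↦ 0` (plumbing). [cite: AbramovichTemkinWlodarczyk2024, Thm. 5.3.1 (2)–(3) (p. 1578)] -/
@[simp] theorem killSlot_C_X_self : killSlot n (C (MvPolynomial.X n)) = (0 : (MvPolynomial ι k)[X]) := by
  rw [killSlot, slotSubst_C_X, killData, if_pos rfl]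

variable {n} in
/-- `ε_j ↦ ε_j` for `j ≠ n` (plumbing). [cite: AbramovichTemkinWlodarczyk2024, Thm. 5.3.1 (2)–(3) (p. 1578)] -/
theorem killSlot_C_X_of_ne {j : ι} (h : j ≠ n) :
    killSlot n (C (MvPolynomial.X j)) = (C (MvPolynomial.X j) : (MvPolynomial ι k)[X]) := by
  rw [killSlot, slotSubst_C_X, killData, if_neg h]

variable {n t}

/-- `killSlot m` fixes every `q ∈ k[ε]` free of `ε_m` (derived here; plumbing). [cite: AbramovichTemkinWlodarczyk2024, Thm. 5.3.1 (2)–(3) (p. 1578)] -/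
theorem killSlot_C_of_notMem {m : ι} {q : MvPolynomial ι k} (h : m ∉ q.vars) : killSlot m (C q) = C q :=
  slotSubst_C_of_forall_mem_vars _ q fun j hj => by rw [killData, if_neg (fun e : j = m => h (e ▸ hj))]

/-- Killing `ε_m` commutes past the shift of ANOTHER slot `ε_n` by a `t` free of `ε_m`, on every `q` free of `ε_m`
(derived here; plumbing). [cite: AbramovichTemkinWlodarczyk2024, Thm. 5.3.1 (2)–(3) (p. 1578)] -/
theorem killSlot_shiftSlot_C {m n : ι} (hmn : m ≠ n) {t : (MvPolynomial ι k)[X]} (ht : killSlot m t = t)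
    {q : MvPolynomial ι k} (hq : m ∉ q.vars) : killSlot m (shiftSlot n t (C q)) = shiftSlot n t (C q) := by
  have key := MvPolynomial.hom_congr_vars (f₁ := (killSlot m).comp ((shiftSlot n t).comp C))
    (f₂ := (shiftSlot n t).comp C) (p₁ := q) (p₂ := q)
    (by ext c; simp only [RingHom.comp_apply, shiftSlot_C_C, killSlot_C_C])
    (fun j hj _ => by
      have hjm : j ≠ m := fun e => hq (e ▸ hj)
      simp only [RingHom.comp_apply]
      by_cases hjn : j = n
      · rw [hjn, shiftSlot_C_X_self, map_add, killSlot_C_X_of_ne hmn.symm, ht]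
      · rw [shiftSlot_C_X_of_ne _ hjn, killSlot_C_X_of_ne hjm])
    rfl
  simpa only [RingHom.comp_apply] using key

/-- Shifting by `σ^p` is shifting by `σ` followed by `σ ↦ σ^p` (`Polynomial.expand`), on `k[ε]` (derived here; plumbing).
[cite: AbramovichTemkinWlodarczyk2024, Thm. 5.3.1 (2)–(3) (p. 1578)] -/
theorem shiftSlot_X_pow_C (n : ι) (p : ℕ) (q : MvPolynomial ι k) :
    shiftSlot n (X ^ p) (C q) = expand (MvPolynomial ι k) p (shiftSlot n X (C q)) := by
  have key : (shiftSlot n ((X : (MvPolynomial ι k)[X]) ^ p)).comp C =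
      (expand (MvPolynomial ι k) p).toRingHom.comp ((shiftSlot n (X : (MvPolynomial ι k)[X])).comp C) := by
    refine MvPolynomial.ringHom_ext (fun c => ?_) (fun j => ?_)
    · simp only [RingHom.comp_apply, shiftSlot_C_C, AlgHom.toRingHom_eq_coe, RingHom.coe_coe, expand_C]
    · by_cases hj : j = n
      · rw [hj]
        simp only [RingHom.comp_apply, shiftSlot_C_X_self, AlgHom.toRingHom_eq_coe, RingHom.coe_coe, map_add, expand_C,
          expand_X]
      · simp only [RingHom.comp_apply, shiftSlot_C_X_of_ne _ hj, AlgHom.toRingHom_eq_coe, RingHom.coe_coe, expand_C]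
  have h := RingHom.congr_fun key q
  simpa only [RingHom.comp_apply, AlgHom.toRingHom_eq_coe, RingHom.coe_coe] using h

/-- `killVar n q` is free of `ε_n`, and free of every variable `q` is free of (derived here; plumbing).
[cite: AbramovichTemkinWlodarczyk2024, Thm. 5.3.1 (2)–(3) (p. 1578)] -/
theorem notMem_vars_killVar [Nontrivial k] (n : ι) (q : MvPolynomial ι k) {i : ι} (h : i = n ∨ i ∉ q.vars) :
    i ∉ (killVar n q).vars := by
  intro hi
  rw [killVar, MvPolynomial.aeval_eq_bind₁] at hi
  obtain ⟨j, hj, hij⟩ := Finset.mem_biUnion.mp (MvPolynomial.vars_bind₁ _ q hi)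
  by_cases hjn : j = n
  · rw [killFun, if_pos hjn, MvPolynomial.vars_0] at hij
    exact Finset.notMem_empty _ hij
  · rw [killFun, if_neg hjn, MvPolynomial.vars_X, Finset.mem_singleton] at hij
    subst hij
    rcases h with h | h
    · exact hjn h
    · exact h hj

/-- Evaluating the one-slot shift `q(ε_n + σ)` at `σ = −ε_n` kills `ε_n`: `q(ε_n + σ)|_{σ = −ε_n} = q|_{ε_n = 0}`
(derived here; plumbing). [cite: AbramovichTemkinWlodarczyk2024, Thm. 5.3.1 (2)–(3) (p. 1578)] -/
theorem eval_neg_X_shiftSlot_X_C (n : ι) (q : MvPolynomial ι k) :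
    (shiftSlot n X (C q)).eval (-MvPolynomial.X n) = killVar n q := by
  have key : (evalRingHom (-MvPolynomial.X n)).comp ((shiftSlot n (X : (MvPolynomial ι k)[X])).comp C) =
      (killVar n : MvPolynomial ι k →ₐ[k] MvPolynomial ι k).toRingHom := by
    refine MvPolynomial.ringHom_ext (fun c => ?_) (fun j => ?_)
    · rw [RingHom.comp_apply, RingHom.comp_apply, shiftSlot_C_C, coe_evalRingHom, eval_C, AlgHom.toRingHom_eq_coe,
        RingHom.coe_coe, MvPolynomial.algHom_C, MvPolynomial.algebraMap_eq]
    · by_cases hj : j = n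
      · rw [hj, RingHom.comp_apply, RingHom.comp_apply, shiftSlot_C_X_self, coe_evalRingHom, eval_add, eval_C, eval_X,
          add_neg_cancel, AlgHom.toRingHom_eq_coe, RingHom.coe_coe, killVar, MvPolynomial.aeval_X, killFun, if_pos rfl]
      · rw [RingHom.comp_apply, RingHom.comp_apply, shiftSlot_C_X_of_ne _ hj, coe_evalRingHom, eval_C,
          AlgHom.toRingHom_eq_coe, RingHom.coe_coe, killVar, MvPolynomial.aeval_X, killFun, if_neg hj]
  have h := RingHom.congr_fun key q
  rwa [RingHom.comp_apply, RingHom.comp_apply, coe_evalRingHom, AlgHom.toRingHom_eq_coe, RingHom.coe_coe] at h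

/-- **(T-p) Translation invariance in one slot forces the slot variable out** (derived here; CARVER-NOTES eng1-g39 (T-p); ANY
characteristic, ANY `q`): `q(ε_n + σ) = q` in `k[ε][σ]` ⇒ `ε_n ∉ vars q` — evaluate at `σ = −ε_n`.  The `k[ε][σ]`-twin of
`InvariantDirection.notMem_vars_of_isInvariantDir_single_one`. [cite: AbramovichTemkinWlodarczyk2024, Thm. 5.3.1 (2)–(3) (p. 1578)] -/
theorem notMem_vars_of_shiftSlot_X_C_eq [Nontrivial k] {n : ι} {q : MvPolynomial ι k} (h : shiftSlot n X (C q) = C q) :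
    n ∉ q.vars := by
  have h1 : killVar n q = q := by rw [← eval_neg_X_shiftSlot_X_C, h, eval_C]
  have h2 := notMem_vars_killVar n q (i := n) (Or.inl rfl)
  rwa [h1] at h2

/-- The same for the shift by `σ^p`, `0 < p`: `q(ε_n + σ^p) = q ⇒ q(ε_n + σ) = q`, since `expand` is injective (derived here).
[cite: AbramovichTemkinWlodarczyk2024, Thm. 5.3.1 (2)–(3) (p. 1578)] -/
theorem shiftSlot_X_C_eq_of_pow {p : ℕ} (hp : 0 < p) {n : ι} {q : MvPolynomial ι k} (h : shiftSlot n (X ^ p) (C q) = C q) :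
    shiftSlot n X (C q) = C q := by
  apply expand_injective hp
  rw [← shiftSlot_X_pow_C, h, expand_C]

/-- `Φ_σ` agrees with the one-slot shift `ε_n ↦ ε_n + σ^p` on every `q` free of `ε_i` (derived here; plumbing).
[cite: AbramovichTemkinWlodarczyk2024, Thm. 5.3.1 (2)–(3) (p. 1578)] -/
theorem g28Subst_C_eq_shiftSlot_C {i n : ι} (ℓ : MvPolynomial ι k) (p : ℕ) {q : MvPolynomial ι k} (hi : i ∉ q.vars) :
    g28Subst i n ℓ p (C q) = shiftSlot n (X ^ p) (C q) := by
  have key := MvPolynomial.hom_congr_vars (f₁ := (g28Subst i n ℓ p).comp C) (f₂ := (shiftSlot n (X ^ p)).comp C)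
    (p₁ := q) (p₂ := q) (by ext c; simp only [RingHom.comp_apply, g28Subst_C_C, shiftSlot_C_C])
    (fun j hj _ => by
      have hji : j ≠ i := fun e => hi (e ▸ hj)
      rw [RingHom.comp_apply, RingHom.comp_apply, g28Subst, shiftSlot, slotSubst_C_X, slotSubst_C_X, g28Data, shiftData,
        if_neg hji])
    rfl
  simpa only [RingHom.comp_apply] using key

end Shift

/-! ### THEOREM U: the fix space of `Φ_σ` -/

section Main

variable {p : ℕ} {i n : ι} {ℓ : MvPolynomial ι k}

/-- **THEOREM U — `Fix(Φ_σ)`, direct inclusion, explicit form** (derived here; CARVER-NOTES eng1-g39 T70).  Over a domain of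
characteristic `p`, `ℓ ≠ 0` free of `ε_i` (freeness of `ε_n` is NOT needed in this direction), `deg_i g < 2p`: if
`Φ_σ(g) = g` then, with `q := g /ᵐ ε_i^p` and
`G₀ := (g %ᵐ ε_i^p)|_{ε_n := 0}`, both `q` and `G₀` are free of `ε_i, ε_n` and `g = q·(ε_i^p − ℓ^p ε_n) + G₀`.
[cite: Lang2002, Ch. V §6 (pp. 247–251)] -/
theorem fixSpace_g28_explicit [Fact p.Prime] [CharP k p] [IsDomain k] (hin : i ≠ n) (hℓi : i ∉ ℓ.vars) (hℓ0 : ℓ ≠ 0)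
    {g : MvPolynomial ι k} (hdeg : g.degreeOf i < 2 * p) (hg : IsIsotropyOf g (g28Subst i n ℓ p)) :
    i ∉ (g.divMonomial (Finsupp.single i p)).vars ∧ n ∉ (g.divMonomial (Finsupp.single i p)).vars ∧
      i ∉ (killVar n (g.modMonomial (Finsupp.single i p))).vars ∧
      n ∉ (killVar n (g.modMonomial (Finsupp.single i p))).vars ∧
      g = g.divMonomial (Finsupp.single i p) * (MvPolynomial.X i ^ p - ℓ ^ p * MvPolynomial.X n) +
        killVar n (g.modMonomial (Finsupp.single i p)) := by
  have hp : p.Prime := Fact.out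
  obtain ⟨hdec, hqi, hg₀i⟩ :=
    decomp_of_pderiv_eq_zero hp.pos (pderiv_eq_zero_of_isIsotropyOf ℓ hp.ne_zero hp.ne_one hℓ0 hg) hdeg
  set q := g.divMonomial (Finsupp.single i p) with hq_def
  set g₀ := g.modMonomial (Finsupp.single i p) with hg₀_def
  -- (E) the isotropy equation after Frobenius `(ε_i + σℓ)^p = ε_i^p + σ^p ℓ^p`
  have E : (C (MvPolynomial.X i) ^ p + X ^ p * C ℓ ^ p) * shiftSlot n (X ^ p) (C q) + shiftSlot n (X ^ p) (C g₀) =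
      C (MvPolynomial.X i) ^ p * C q + C g₀ := by
    have h : g28Subst i n ℓ p (C g) = C g := hg
    rw [hdec] at h
    simp only [map_add, map_mul, map_pow, g28Subst_C_X_fst, g28Subst_C_eq_shiftSlot_C ℓ p hqi,
      g28Subst_C_eq_shiftSlot_C ℓ p hg₀i] at h
    rw [add_pow_char _ _ p, mul_pow] at h
    exact h
  -- (E0) kill `ε_i`
  have hKt : killSlot i ((X : (MvPolynomial ι k)[X]) ^ p) = X ^ p := by rw [map_pow, killSlot_X]
  have hKq : killSlot i (shiftSlot n (X ^ p) (C q)) = shiftSlot n (X ^ p) (C q) := killSlot_shiftSlot_C hin hKt hqi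
  have hKg₀ : killSlot i (shiftSlot n (X ^ p) (C g₀)) = shiftSlot n (X ^ p) (C g₀) := killSlot_shiftSlot_C hin hKt hg₀i
  have hKℓ : killSlot i (C ℓ) = C ℓ := killSlot_C_of_notMem hℓi
  have E0 : X ^ p * C ℓ ^ p * shiftSlot n (X ^ p) (C q) + shiftSlot n (X ^ p) (C g₀) = C g₀ := by
    have h := congrArg (killSlot i) E
    simp only [map_add, map_mul, map_pow, killSlot_C_X_self, killSlot_X, hKq, hKg₀, hKℓ, killSlot_C_of_notMem hg₀i,
      zero_pow hp.ne_zero, zero_add, zero_mul] at h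
    exact h
  -- (E1) `q(ε_n + σ^p) = q`, hence `ε_n ∉ vars q` by (T-p)
  have hCX : (C (MvPolynomial.X i) : (MvPolynomial ι k)[X]) ^ p ≠ 0 :=
    pow_ne_zero _ (C_ne_zero.mpr (MvPolynomial.X_ne_zero i))
  have E1 : shiftSlot n (X ^ p) (C q) = C q := by
    have h : C (MvPolynomial.X i) ^ p * (shiftSlot n (X ^ p) (C q) - C q) = 0 := by linear_combination E - E0
    exact sub_eq_zero.mp ((mul_eq_zero.mp h).resolve_left hCX)
  have hqn : n ∉ q.vars := notMem_vars_of_shiftSlot_X_C_eq (shiftSlot_X_C_eq_of_pow hp.pos E1)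
  -- (E2) `g₀(ε_n + σ) = g₀ − σ ℓ^p q`, by injectivity of `expand`
  have E2 : shiftSlot n X (C g₀) = C g₀ - X * (C ℓ ^ p * C q) := by
    apply expand_injective hp.pos
    rw [← shiftSlot_X_pow_C]
    simp only [map_sub, map_mul, map_pow, expand_C, expand_X]
    linear_combination E0 - X ^ p * C ℓ ^ p * E1
  -- (E3) evaluate at `σ = −ε_n`
  have E3 : killVar n g₀ = g₀ + MvPolynomial.X n * ℓ ^ p * q := by
    rw [← eval_neg_X_shiftSlot_X_C, E2]
    simp only [eval_sub, eval_mul, eval_pow, eval_C, eval_X]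
    ring
  refine ⟨hqi, hqn, notMem_vars_killVar n g₀ (Or.inr hg₀i), notMem_vars_killVar n g₀ (Or.inl rfl), ?_⟩
  rw [E3]
  linear_combination hdec

/-- **THEOREM U — the fix space of `Φ_σ`, both inclusions** (derived here; CARVER-NOTES eng1-g39 T70 — stated for ANY nonzero
`ℓ` free of `ε_i, ε_n`, no parity or weight hypothesis): over a domain of characteristic `p` and for `deg_i g < 2p`,
`Φ_σ(g) = g  ⇔  g = q·(ε_i^p − ℓ^p ε_n) + G₀` with `q, G₀ ∈ k[ε]` free of `ε_i, ε_n`.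
`⇐` is `isIsotropyOf_g28_mul`. [cite: Lang2002, Ch. V §6 (pp. 247–251)] -/
theorem isIsotropyOf_g28Subst_iff [Fact p.Prime] [CharP k p] [IsDomain k] (hin : i ≠ n) (hℓi : i ∉ ℓ.vars)
    (hℓn : n ∉ ℓ.vars) (hℓ0 : ℓ ≠ 0) {g : MvPolynomial ι k} (hdeg : g.degreeOf i < 2 * p) :
    IsIsotropyOf g (g28Subst i n ℓ p) ↔ ∃ q G₀ : MvPolynomial ι k, i ∉ q.vars ∧ n ∉ q.vars ∧ i ∉ G₀.vars ∧ n ∉ G₀.vars ∧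
      g = q * (MvPolynomial.X i ^ p - ℓ ^ p * MvPolynomial.X n) + G₀ := by
  refine ⟨fun hg => ?_, ?_⟩
  · obtain ⟨hqi, hqn, hGi, hGn, heq⟩ := fixSpace_g28_explicit hin hℓi hℓ0 hdeg hg
    exact ⟨_, _, hqi, hqn, hGi, hGn, heq⟩
  · rintro ⟨q, G₀, hqi, hqn, hGi, hGn, rfl⟩
    exact isIsotropyOf_g28_mul ℓ p hin hℓi hℓn hqi hqn hGi hGn

end Main

/-! ### Positive weights: the weighted-homogeneous reading (`q = a ∈ k`) -/

section Weighted

omit [DecidableEq ι] in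
/-- Positive rational weights: each exponent is controlled by the weight, `d j · w j ≤ weight_w d` (derived here; bookkeeping).
[cite: AbramovichTemkinWlodarczyk2024, §5.1 (p. 1575)] -/
theorem natCast_mul_le_weight {w : ι → ℚ} (hw : ∀ j, 0 < w j) (d : ι →₀ ℕ) (j : ι) :
    (d j : ℚ) * w j ≤ Finsupp.weight w d := by
  rw [Finsupp.weight_apply, Finsupp.sum]
  have hnn : ∀ l ∈ d.support, (0 : ℚ) ≤ d l • w l := fun l _ => by
    rw [nsmul_eq_mul]; exact mul_nonneg (Nat.cast_nonneg _) (hw l).le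
  by_cases hj : j ∈ d.support
  · have h := Finset.single_le_sum (f := fun l => d l • w l) hnn hj
    rwa [nsmul_eq_mul] at h
  · rw [Finsupp.notMem_support_iff.mp hj, Nat.cast_zero, zero_mul]
    exact Finset.sum_nonneg hnn

omit [DecidableEq ι] in
/-- Positive rational weights: a monomial of weight `0` is trivial (derived here; bookkeeping).
[cite: AbramovichTemkinWlodarczyk2024, §5.1 (p. 1575)] -/
theorem eq_zero_of_weight_eq_zero {w : ι → ℚ} (hw : ∀ j, 0 < w j) {d : ι →₀ ℕ} (hd : Finsupp.weight w d = 0) : d = 0 := by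
  ext j
  have h := natCast_mul_le_weight hw d j
  rw [hd, ← zero_mul (w j)] at h
  rw [Finsupp.coe_zero, Pi.zero_apply]
  exact Nat.cast_nonpos.mp (le_of_mul_le_mul_right h (hw j))

omit [DecidableEq ι] in
/-- Positive rational weights: a weighted-homogeneous polynomial of weight `0` is a constant (derived here; bookkeeping).
[cite: AbramovichTemkinWlodarczyk2024, §5.1 (p. 1575)] -/
theorem eq_C_of_isWeightedHomogeneous_zero {w : ι → ℚ} (hw : ∀ j, 0 < w j) {q : MvPolynomial ι k}
    (hq : MvPolynomial.IsWeightedHomogeneous w q 0) : q = MvPolynomial.C (q.coeff 0) := by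
  classical
  ext d
  rw [MvPolynomial.coeff_C]
  split_ifs with hd
  · rw [← hd]
  · by_contra hne
    exact hd (eq_zero_of_weight_eq_zero hw (hq hne)).symm

omit [DecidableEq ι] in
/-- `g /ᵐ s` of a weighted-homogeneous `g` is weighted-homogeneous of the complementary weight (derived here; bookkeeping).
[cite: AbramovichTemkinWlodarczyk2024, §5.1 (p. 1575)] -/
theorem isWeightedHomogeneous_divMonomial {M : Type*} [AddCommGroup M] {w : ι → M} {g : MvPolynomial ι k} {μ : M}
    (hg : MvPolynomial.IsWeightedHomogeneous w g μ) (s : ι →₀ ℕ) :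
    MvPolynomial.IsWeightedHomogeneous w (g.divMonomial s) (μ - Finsupp.weight w s) := by
  intro d hd
  rw [MvPolynomial.coeff_divMonomial] at hd
  have h := hg hd
  rw [map_add] at h
  exact eq_sub_of_add_eq' h

variable {p : ℕ} {i n : ι} {ℓ : MvPolynomial ι k}

/-- **THEOREM U — `Fix(Φ_σ) = a·(f₁^p − ℓ^p W_n) ⊕ {G₀}`** (derived here; CARVER-NOTES eng1-g39 T70, verbatim reading).  Over a
domain of characteristic `p`, positive weights `w : ι → ℚ`, `ℓ ≠ 0` free of `ε_i, ε_n`, and `g` weighted-homogeneous of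
the weight `p·w i` of `ε_i^p` (engine 1: `w(f₁) = 1/p`, weight `1`): `Φ_σ(g) = g  ⇔  g = a·(ε_i^p − ℓ^p ε_n) + G₀`
(`g28Face a i n ℓ p G₀`) with `a ∈ k` and `G₀` free of `ε_i, ε_n`.  The degree bound `deg_i g ≤ p` and `q ∈ k` come from the
weights; `⇐` is `isIsotropyOf_g28`.  INSTRUMENT (the Fix-space bookkeeping of engine 1's THEOREM U), NOT a resolution theorem.
[cite: AbramovichTemkinWlodarczyk2024, Thm. 5.3.1 (2)–(3) (p. 1578)] -/
theorem isIsotropyOf_g28Subst_iff_of_isWeightedHomogeneous [Fact p.Prime] [CharP k p] [IsDomain k] (hin : i ≠ n)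
    (hℓi : i ∉ ℓ.vars) (hℓn : n ∉ ℓ.vars) (hℓ0 : ℓ ≠ 0) {w : ι → ℚ} (hw : ∀ j, 0 < w j) {μ : ℚ} (hμ : (p : ℚ) * w i = μ)
    {g : MvPolynomial ι k} (hg : MvPolynomial.IsWeightedHomogeneous w g μ) :
    IsIsotropyOf g (g28Subst i n ℓ p) ↔
      ∃ (a : k) (G₀ : MvPolynomial ι k), i ∉ G₀.vars ∧ n ∉ G₀.vars ∧ g = g28Face a i n ℓ p G₀ := by
  have hp : p.Prime := Fact.out
  have hp0 : 0 < p := hp.pos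
  refine ⟨fun hgi => ?_, ?_⟩
  · have hdeg : g.degreeOf i < 2 * p := by
      refine lt_of_le_of_lt ((MvPolynomial.degreeOf_le_iff (d := p)).mpr fun d hd => ?_) (by omega)
      have h1 : (d i : ℚ) * w i ≤ μ :=
        (natCast_mul_le_weight hw d i).trans (hg (MvPolynomial.mem_support_iff.mp hd)).le
      rw [← hμ] at h1
      exact_mod_cast le_of_mul_le_mul_right h1 (hw i)
    obtain ⟨-, -, hGi, hGn, heq⟩ := fixSpace_g28_explicit hin hℓi hℓ0 hdeg hgi
    have hq0 : MvPolynomial.IsWeightedHomogeneous w (g.divMonomial (Finsupp.single i p)) 0 := by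
      have h := isWeightedHomogeneous_divMonomial hg (Finsupp.single i p)
      rwa [Finsupp.weight_single, nsmul_eq_mul, hμ, sub_self] at h
    refine ⟨(g.divMonomial (Finsupp.single i p)).coeff 0, _, hGi, hGn, ?_⟩
    rw [g28Face, ← eq_C_of_isWeightedHomogeneous_zero hw hq0]
    exact heq
  · rintro ⟨a, G₀, hGi, hGn, rfl⟩
    exact isIsotropyOf_g28 ℓ p hin hℓi hℓn hGi hGn a

end Weighted

/-! ### T71′ (eng1-g39 remark): slot data in `σ^m` — `Φ = Ψ(σ := σ^m)` fixes the same `g ∈ k[ε]` as `Ψ` -/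

section Expand

omit [DecidableEq ι] in
/-- **T71′ dictionary** (derived here; CARVER-NOTES eng1-g39 T71′: "if every `σ`-exponent occurring in a graded substitution `Φ` is divisible by `k`,
then `Φ = Ψ(σ^k)` for a graded substitution `Ψ`"): composing the slot data with `σ ↦ σ^m` composes the action on `k[ε]` with `expand_m`.
[cite: AbramovichTemkinWlodarczyk2024, Thm. 5.3.1 (2)–(3) (p. 1578)] -/
theorem slotSubst_expand_C (u : ι → (MvPolynomial ι k)[X]) (m : ℕ) (q : MvPolynomial ι k) :
    slotSubst (fun j => expand (MvPolynomial ι k) m (u j)) (C q) = expand (MvPolynomial ι k) m (slotSubst u (C q)) := by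
  have key : (slotSubst fun j => expand (MvPolynomial ι k) m (u j)).comp C =
      (expand (MvPolynomial ι k) m).toRingHom.comp ((slotSubst u).comp C) := by
    refine MvPolynomial.ringHom_ext (fun c => ?_) (fun j => ?_)
    · simp only [RingHom.comp_apply, slotSubst_C_C, AlgHom.toRingHom_eq_coe, RingHom.coe_coe, expand_C]
    · simp only [RingHom.comp_apply, slotSubst_C_X, AlgHom.toRingHom_eq_coe, RingHom.coe_coe]
  have h := RingHom.congr_fun key q
  simpa only [RingHom.comp_apply, AlgHom.toRingHom_eq_coe, RingHom.coe_coe] using h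

omit [DecidableEq ι] in
/-- **T71′** (derived here): `Fix(Φ) = Fix(Ψ)` on `k[ε]` for `Φ = Ψ(σ := σ^m)`, `0 < m` (`expand_m` is injective) — so every statement about the
fixed faces of `Ψ` (e.g. (T-p) / ND0: a purely shifted slot does not occur) transfers to `Φ`. [cite: AbramovichTemkinWlodarczyk2024, Thm. 5.3.1 (2)–(3) (p. 1578)] -/
theorem isIsotropyOf_slotSubst_expand_iff (u : ι → (MvPolynomial ι k)[X]) {m : ℕ} (hm : 0 < m) (g : MvPolynomial ι k) :
    IsIsotropyOf g (slotSubst fun j => expand (MvPolynomial ι k) m (u j)) ↔ IsIsotropyOf g (slotSubst u) := by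
  unfold IsIsotropyOf
  rw [slotSubst_expand_C]
  constructor
  · intro h
    apply expand_injective hm
    rwa [expand_C]
  · intro h
    rw [h, expand_C]

/-- T71′ applied to the pure shift (derived here): `ε_n ↦ ε_n + σ^m` fixes `q` iff `ε_n ↦ ε_n + σ` does (`0 < m`), iff — by (T-p) — `ε_n ∉ vars q`
(`notMem_vars_of_shiftSlot_X_C_eq`; the converse is `slotSubst_C_of_forall_mem_vars`). [cite: AbramovichTemkinWlodarczyk2024, Thm. 5.3.1 (2)–(3) (p. 1578)] -/
theorem shiftSlot_X_pow_C_eq_iff [Nontrivial k] (n : ι) {m : ℕ} (hm : 0 < m) (q : MvPolynomial ι k) :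
    shiftSlot n (X ^ m) (C q) = C q ↔ n ∉ q.vars := by
  constructor
  · intro h
    exact notMem_vars_of_shiftSlot_X_C_eq (shiftSlot_X_C_eq_of_pow hm h)
  · intro hn
    refine slotSubst_C_of_forall_mem_vars _ q fun j hj => ?_
    have hjn : j ≠ n := fun h => hn (h ▸ hj)
    simp only [shiftData, if_neg hjn]

end Expand

end FixSpace


end

end Literature.AlgebraicGeometry.Resolution.WeightedBlowup.G28Face
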